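import Literature.Geometry.GaugeTheory.SelfDualFormsSpinors
import HarnessLib

/-!
# The symbol of `d* ⊕ d⁺` and of the Dirac operator: the Seiberg–Witten deformation complex is
# elliptic (Morgan 1996, §4.6; Atiyah–Hitchin–Singer 1978)

Topic `Literature/Geometry/GaugeTheory`; model-level algebra on `V = ℝ⁴ = ℍ`, continuing
`SelfDualFormsSpinors` (`sdCoeff`: the three self-dual components `ω₀₁ + ω₂₃, ω₀₂ + ω₃₁, ω₀₃ + ω₁₂`
of a 2-form) and `SpinorAlgebraFour` (`cliffordGamma`).

Morgan 1996, §4.6: the deformation complex `ℰ(A, ψ)` of the Seiberg–Witten equations deforms,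
through zeroth order terms, to the direct sum of
`0 → Ω⁰(iℝ) —2d→ Ω¹(iℝ) —P₊d→ Ω²₊(iℝ) → 0` and `0 → Γ(S⁺) —∂_A→ Γ(S⁻) → 0`, and "Clearly, each of
these complexes is elliptic, proving that the original one is also" (whence the dimension formula
`d = (c₁(L)² - 2χ - 3σ)/4`, Cor. 4.6.2). Ellipticity is exactness of the principal symbol sequences
for every `ξ ≠ 0`:

* `0 → Λ⁰ —ξ·→ Λ¹ —P₊(ξ ∧ ·)→ Λ²₊ → 0`, equivalently bijectivity of the rolled-up symbol of
  `d* ⊕ d⁺`, `α ↦ (⟨ξ, α⟩, (ξ ∧ α)⁺)` — here PROVED from the quaternion identity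
  `ξ ᾱ = ⟨ξ, α⟩ - Σ_k (ξ ∧ α)⁺_k e_k` (`toQuat_mul_star`): `sdSymbol_injective`,
  `sdSymbol_surjective`, `sdCoeff_wedge_eq_zero_iff` (the kernel of `P₊(ξ ∧ ·)` on `Λ¹` is the
  line `ℝ ξ`), `sdCoeff_wedge_surjective`;
* the symbol `γ(ξ) : S → S` of the Dirac operator is invertible for `ξ ≠ 0`
  (`cliffordGamma_mul_cliffordGamma_inv`, from `γ(ξ)² = -|ξ|²`).

0 new facts.

## References

* J. W. Morgan, *The Seiberg–Witten Equations and Applications to the Topology of Smooth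
  Four-Manifolds*, Princeton Math. Notes 44 (1996), §4.6. [MorganSWBook1996]
* M. F. Atiyah, N. J. Hitchin, I. M. Singer, *Self-duality in four-dimensional Riemannian
  geometry*, Proc. R. Soc. A 362 (1978), §6 (the elliptic complex `Ω⁰ → Ω¹ → Ω²₊`). [AtiyahHitchinSinger1978]
-/

noncomputable section

open Matrix Quaternion
open scoped Quaternion

namespace Literature.Geometry.GaugeTheory

/-! ### Covectors as quaternions; the wedge product as a coefficient matrix -/

/-- A covector `ξ = Σ ξ_a e^a` of `ℝ⁴` as the quaternion `ξ₀ + ξ₁ i + ξ₂ j + ξ₃ k`. [folklore] -/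
def toQuat (ξ : Fin 4 → ℝ) : ℍ := ⟨ξ 0, ξ 1, ξ 2, ξ 3⟩

/-- `toQuat` is additive. [folklore] -/
theorem toQuat_add (ξ α : Fin 4 → ℝ) : toQuat (ξ + α) = toQuat ξ + toQuat α := by
  ext <;> simp [toQuat]

/-- `toQuat` is homogeneous. [folklore] -/
theorem toQuat_smul (c : ℝ) (ξ : Fin 4 → ℝ) : toQuat (c • ξ) = c • toQuat ξ := by
  ext <;> simp [toQuat]

/-- `toQuat` is injective. [folklore] -/
theorem toQuat_injective : Function.Injective toQuat := by
  intro ξ α h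
  have h0 := congr_arg (fun q : ℍ ↦ q.re) h
  have h1 := congr_arg (fun q : ℍ ↦ q.imI) h
  have h2 := congr_arg (fun q : ℍ ↦ q.imJ) h
  have h3 := congr_arg (fun q : ℍ ↦ q.imK) h
  simp only [toQuat] at h0 h1 h2 h3
  ext a; fin_cases a <;> assumption

/-- `toQuat ξ = 0 ↔ ξ = 0`. [folklore] -/
theorem toQuat_eq_zero_iff (ξ : Fin 4 → ℝ) : toQuat ξ = 0 ↔ ξ = 0 := by
  constructor
  · intro h
    apply toQuat_injective
    rw [h]; ext <;> simp [toQuat]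
  · rintro rfl; ext <;> simp [toQuat]

/-- The quaternion with prescribed components (inverse of `toQuat`). [folklore] -/
def ofQuat (q : ℍ) : Fin 4 → ℝ := ![q.re, q.imI, q.imJ, q.imK]

/-- `toQuat ∘ ofQuat = id`. [folklore] -/
@[simp] theorem toQuat_ofQuat (q : ℍ) : toQuat (ofQuat q) = q := by
  ext <;> simp [toQuat, ofQuat]

/-- **The wedge product of two covectors** as a coefficient matrix: `(ξ ∧ α)_{ab} = ξ_a α_b - ξ_b α_a`.
[cite: MorganSWBook1996, §4.6] -/
def wedgeMatrix (ξ α : Fin 4 → ℝ) : Matrix (Fin 4) (Fin 4) ℝ :=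
  Matrix.of fun a b ↦ ξ a * α b - ξ b * α a

/-- Unfolding `wedgeMatrix`. [folklore] -/
@[simp] theorem wedgeMatrix_apply (ξ α : Fin 4 → ℝ) (a b : Fin 4) :
    wedgeMatrix ξ α a b = ξ a * α b - ξ b * α a := rfl

/-- `ξ ∧ α` is a 2-form (antisymmetric). [folklore] -/
theorem isTwoForm_wedgeMatrix (ξ α : Fin 4 → ℝ) : IsTwoForm (wedgeMatrix ξ α) := by
  ext a b; simp [wedgeMatrix, Matrix.transpose_apply]

/-- `ξ ∧ ξ = 0`. [folklore] -/
@[simp] theorem wedgeMatrix_self (ξ : Fin 4 → ℝ) : wedgeMatrix ξ ξ = 0 := by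
  ext a b; simp [wedgeMatrix, mul_comm]

/-- The wedge product is linear in the second factor: additivity. [folklore] -/
theorem wedgeMatrix_add (ξ α β : Fin 4 → ℝ) : wedgeMatrix ξ (α + β) = wedgeMatrix ξ α + wedgeMatrix ξ β := by
  ext a b; simp [wedgeMatrix]; ring

/-- … and homogeneity. [folklore] -/
theorem wedgeMatrix_smul (ξ : Fin 4 → ℝ) (c : ℝ) (α : Fin 4 → ℝ) : wedgeMatrix ξ (c • α) = c • wedgeMatrix ξ α := by
  ext a b; simp [wedgeMatrix]; ring

/-- `sdCoeff 0 = 0`. [folklore] -/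
@[simp] theorem sdCoeff_zero : sdCoeff 0 = 0 := by
  ext k; fin_cases k <;> simp [sdCoeff]

/-- `sdCoeff` commutes with scalars. [folklore] -/
theorem sdCoeff_smul (c : ℝ) (ω : Matrix (Fin 4) (Fin 4) ℝ) : sdCoeff (c • ω) = c • sdCoeff ω := by
  ext k; fin_cases k <;> simp [sdCoeff] <;> ring

/-! ### The symbol of `d* ⊕ d⁺` -/

/-- **The principal symbol of `d* ⊕ d⁺ : Ω¹ → Ω⁰ ⊕ Ω²₊` at the covector `ξ`** (up to the factor `i`
and signs): `α ↦ (⟨ξ, α⟩, (ξ ∧ α)⁺)`, the self-dual part recorded by its three components `sdCoeff`.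
[cite: MorganSWBook1996, §4.6] -/
def sdSymbol (ξ α : Fin 4 → ℝ) : ℝ × (Fin 3 → ℝ) :=
  (∑ a, ξ a * α a, sdCoeff (wedgeMatrix ξ α))

/-- **The quaternion identity behind ellipticity**: `ξ ᾱ = ⟨ξ, α⟩ - Σ_k (ξ ∧ α)⁺_k e_{k+1}` — the real
part of `ξ ᾱ` is the inner product and its imaginary part is minus the self-dual part of `ξ ∧ α`.
[cite: AtiyahHitchinSinger1978, §6] -/
theorem toQuat_mul_star (ξ α : Fin 4 → ℝ) :
    toQuat ξ * star (toQuat α) =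
      ⟨(sdSymbol ξ α).1, -(sdSymbol ξ α).2 0, -(sdSymbol ξ α).2 1, -(sdSymbol ξ α).2 2⟩ := by
  ext <;> simp [toQuat, sdSymbol, sdCoeff, wedgeMatrix, Fin.sum_univ_four, Quaternion.re_mul, Quaternion.imI_mul,
    Quaternion.imJ_mul, Quaternion.imK_mul] <;> ring

/-- The symbol determines `ξ ᾱ`, hence (for `ξ ≠ 0`) `α`: **injectivity of the symbol of `d* ⊕ d⁺`**
— exactness of `0 → Λ⁰ → Λ¹ → Λ²₊` at `Λ¹` together with injectivity modulo `ℝξ`. [cite: MorganSWBook1996, §4.6] -/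
theorem sdSymbol_injective {ξ : Fin 4 → ℝ} (hξ : ξ ≠ 0) : Function.Injective (sdSymbol ξ) := by
  intro α β h
  have hq : toQuat ξ * star (toQuat α) = toQuat ξ * star (toQuat β) := by
    rw [toQuat_mul_star, toQuat_mul_star, h]
  have hξq : toQuat ξ ≠ 0 := fun h0 ↦ hξ ((toQuat_eq_zero_iff ξ).1 h0)
  have hs : star (toQuat α) = star (toQuat β) := mul_left_cancel₀ hξq hq
  exact toQuat_injective (star_injective hs)

/-- **Surjectivity of the symbol of `d* ⊕ d⁺`** (for `ξ ≠ 0`): every `(r, a) ∈ Λ⁰ ⊕ Λ²₊` is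
`(⟨ξ, α⟩, (ξ ∧ α)⁺)` for `α = \\overline{ξ⁻¹ (r - Σ a_k e_{k+1})}` — in particular `P₊(ξ ∧ ·) : Λ¹ → Λ²₊`
is onto (exactness at `Λ²₊`). [cite: MorganSWBook1996, §4.6] -/
theorem sdSymbol_surjective {ξ : Fin 4 → ℝ} (hξ : ξ ≠ 0) : Function.Surjective (sdSymbol ξ) := by
  intro t
  have hξq : toQuat ξ ≠ 0 := fun h0 ↦ hξ ((toQuat_eq_zero_iff ξ).1 h0)
  set target : ℍ := ⟨t.1, -t.2 0, -t.2 1, -t.2 2⟩ with htarget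
  refine ⟨ofQuat (star ((toQuat ξ)⁻¹ * target)), ?_⟩
  have h := toQuat_mul_star ξ (ofQuat (star ((toQuat ξ)⁻¹ * target)))
  rw [toQuat_ofQuat, star_star, ← mul_assoc, mul_inv_cancel₀ hξq, one_mul, htarget] at h
  have h0 := congr_arg (fun q : ℍ ↦ q.re) h
  have h1 := congr_arg (fun q : ℍ ↦ q.imI) h
  have h2 := congr_arg (fun q : ℍ ↦ q.imJ) h
  have h3 := congr_arg (fun q : ℍ ↦ q.imK) h
  simp only at h0 h1 h2 h3
  refine Prod.ext h0.symm ?_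
  funext k
  fin_cases k
  · simpa using h1.symm
  · simpa using h2.symm
  · simpa using h3.symm

/-- **The kernel of `P₊(ξ ∧ ·)` on `Λ¹` is the line `ℝ ξ`** (exactness of the symbol sequence at
`Λ¹`: `(ξ ∧ α)⁺ = 0 ↔ α ∈ ℝ ξ`, for `ξ ≠ 0`). [cite: MorganSWBook1996, §4.6] -/
theorem sdCoeff_wedge_eq_zero_iff {ξ : Fin 4 → ℝ} (hξ : ξ ≠ 0) (α : Fin 4 → ℝ) :
    sdCoeff (wedgeMatrix ξ α) = 0 ↔ ∃ c : ℝ, α = c • ξ := by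
  constructor
  · intro h0
    -- `ξ ᾱ` is real, so `α` is a real multiple of `ξ`
    have hnorm : (∑ a, ξ a * ξ a) ≠ 0 := by
      intro hz
      apply hξ
      have hsq : ∀ a, ξ a * ξ a = 0 := by
        intro a
        have hle : ∀ b ∈ (Finset.univ : Finset (Fin 4)), 0 ≤ ξ b * ξ b := fun b _ ↦ mul_self_nonneg (ξ b)
        exact (Finset.sum_eq_zero_iff_of_nonneg hle).1 hz a (Finset.mem_univ a)
      ext a
      exact mul_self_eq_zero.1 (hsq a)
    set c : ℝ := (∑ a, ξ a * α a) / ∑ a, ξ a * ξ a with hc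
    refine ⟨c, ?_⟩
    apply sdSymbol_injective hξ
    have h2 : sdCoeff (wedgeMatrix ξ (c • ξ)) = 0 := by
      rw [wedgeMatrix_smul, wedgeMatrix_self, smul_zero, sdCoeff_zero]
    have h1 : ∑ a, ξ a * (c • ξ) a = ∑ a, ξ a * α a := by
      simp only [Pi.smul_apply, smul_eq_mul]
      rw [show ∑ x, ξ x * (c * ξ x) = c * ∑ x, ξ x * ξ x by
        rw [Finset.mul_sum]; exact Finset.sum_congr rfl fun x _ ↦ by ring, hc]
      exact div_mul_cancel₀ _ hnorm
    unfold sdSymbol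
    rw [h0, h2, h1]
  · rintro ⟨c, rfl⟩
    rw [wedgeMatrix_smul, wedgeMatrix_self, smul_zero, sdCoeff_zero]

/-- **`P₊(ξ ∧ ·) : Λ¹ → Λ²₊` is onto** for `ξ ≠ 0` (exactness at `Λ²₊`). [cite: MorganSWBook1996, §4.6] -/
theorem sdCoeff_wedge_surjective {ξ : Fin 4 → ℝ} (hξ : ξ ≠ 0) (a : Fin 3 → ℝ) :
    ∃ α : Fin 4 → ℝ, sdCoeff (wedgeMatrix ξ α) = a := by
  obtain ⟨α, hα⟩ := sdSymbol_surjective hξ (0, a)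
  exact ⟨α, congr_arg Prod.snd hα⟩

/-! ### The symbol of the Dirac operator -/

/-- **The symbol `γ(ξ)` of the Dirac operator is invertible for `ξ ≠ 0`**, with inverse
`-|ξ|⁻² γ(ξ)` (`γ(ξ)² = -|ξ|²`; "`0 → Γ(S⁺) —∂_A→ Γ(S⁻) → 0` ... is elliptic", Morgan 1996, §4.6).
[cite: MorganSWBook1996, §4.6] -/
theorem cliffordGamma_mul_cliffordGamma_inv {x : ℍ} (hx : x ≠ 0) :
    cliffordGamma x * (-(((normSq x)⁻¹ : ℝ) : ℂ) • cliffordGamma x) = 1 := by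
  have hn : normSq x ≠ 0 := fun h ↦ hx (Quaternion.normSq_eq_zero.1 h)
  rw [Matrix.mul_smul, cliffordGamma_mul_self, smul_neg, neg_smul, neg_neg, smul_smul, ← Complex.ofReal_mul,
    inv_mul_cancel₀ hn, Complex.ofReal_one, one_smul]

/-- … and on the other side. [cite: MorganSWBook1996, §4.6] -/
theorem cliffordGamma_inv_mul_cliffordGamma {x : ℍ} (hx : x ≠ 0) :
    (-(((normSq x)⁻¹ : ℝ) : ℂ) • cliffordGamma x) * cliffordGamma x = 1 := by
  have hn : normSq x ≠ 0 := fun h ↦ hx (Quaternion.normSq_eq_zero.1 h)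
  rw [Matrix.smul_mul, cliffordGamma_mul_self, smul_neg, neg_smul, neg_neg, smul_smul, ← Complex.ofReal_mul,
    inv_mul_cancel₀ hn, Complex.ofReal_one, one_smul]

/-- Hence `γ(ξ) s = 0` only for `s = 0` (the Dirac symbol is injective). [cite: MorganSWBook1996, §4.6] -/
theorem cliffordGamma_mulVec_eq_zero_iff {x : ℍ} (hx : x ≠ 0) (s : Spinor → ℂ) :
    cliffordGamma x *ᵥ s = 0 ↔ s = 0 := by
  constructor
  · intro h
    have h' := congr_arg (fun t ↦ (-(((normSq x)⁻¹ : ℝ) : ℂ) • cliffordGamma x) *ᵥ t) h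
    simp only [Matrix.mulVec_mulVec, cliffordGamma_inv_mul_cliffordGamma hx, Matrix.one_mulVec, Matrix.mulVec_zero] at h'
    exact h'
  · rintro rfl; exact Matrix.mulVec_zero _

end Literature.Geometry.GaugeTheory
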